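import Summits.ABC.IUTFork.Cor312Chain
import HarnessLib

/-!
# [IUTchIII] Cor. 3.12 — every node solved for its content; the chain modulo the one disputed inference

Record-only file (D-0012) of the abc-iut cell (Cor. 3.12 STRATEGY TEAM A «direct III§3», D-0067, seat
abc-iut-c312-9 = A1, rows A-4/A-5 of `HOME/plan/C312-TEAMS.md`); TAKES NO SIDE; proof-only. In the team's
assembly every cited locus is granted (`hL : ∀ c, L c` — the loci are the landed/frozen definitions and the
FACT-LIST), so what each printed node contributes beyond bookkeeping is its CONTENT IMPLICATION "invoked
observations ⟹ drawn observations". This file: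

* `Step.holds_of_content` / `chain_of_contents` — a node holds once its content implication does; the chain
  holds once all twenty do (the loci premises are dropped, being granted at assembly).
* named per-step forms for the opening paragraph and Steps (i)–(ix) (p. 174 l. 20 – p. 180 l. 42) — the ten
  nodes before Step (x); observation arguments explicit, for the team's honest readings to discharge
  (c312-10's `Cor312StepXReal` does (x); the (xi)-nodes: A-2 row, c312-4's `Cor312StepXIdeReal`,
  `Cor312StepXIfChain`).
* `cor312_of_contents_and_gap` — **the whole printed proof, modulo the one disputed inference**: granting
  every locus, the content implications of every node EXCEPT (xi-f), the (xi-f) implication in its solved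
  form (`Cor312StepXIfChain.xi_f_holds_iff`), and the two real edges, Cor. 3.12 follows. The team's positive
  target and its GAP statement meet in the hypothesis `hgap`.

[claim: Mochizuki2012, status: disputed] Deliberately NOT here: the honest readings (A-0…A-3 files and the
assembly), any claim that `hgap` holds for an instantiated setting, any judgement.
-/

namespace Summit.ABC

namespace IUTFork

namespace Cor312Proof

open Locus Obs

variable {L : Locus → Prop} {O : Obs → Prop}

/-! ## 1. Generic: a node holds once its content implication does -/

/-- A node holds under `(L, O)` once its CONTENT IMPLICATION "invoked observations ⟹ drawn observations"
holds — the citation premise is simply dropped (it is granted at assembly, where every locus is a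
landed/frozen definition or a FACT-LIST member). [folklore] -/
theorem Step.holds_of_content (s : Step)
    (h : (∀ o ∈ s.uses, O o) → ∀ o ∈ s.concl, O o) : s.Holds L O :=
  fun _ hu => h hu

/-- The chain holds once every node's content implication does. [folklore] -/
theorem chain_of_contents (h : ∀ s : Step, (∀ o ∈ s.uses, O o) → ∀ o ∈ s.concl, O o) : Chain L O :=
  fun s => s.holds_of_content (h s)

/-! ## 2. The ten nodes before Step (x), content arguments explicit -/

/-- Opening ¶ (p. 174 l. 20 – p. 175 l. 13): draws `restrictToStrips`, invokes nothing. [folklore] -/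
theorem wlog_holds_of (h : O .restrictToStrips) : Step.wlog.Holds L O :=
  Step.wlog.holds_of_content fun _ o ho => by
    have : o = Obs.restrictToStrips := by simpa [Step.concl, Step.data] using ho
    subst this; exact h

/-- Step (i) (p. 175 l. 19–49): draws `linkSplits` and `valueGroupMapsPilots`, invokes nothing. [folklore] -/
theorem i_holds_of (h1 : O .linkSplits) (h2 : O .valueGroupMapsPilots) : Step.i.Holds L O :=
  Step.i.holds_of_content fun _ o ho => by
    have : o = Obs.linkSplits ∨ o = Obs.valueGroupMapsPilots := by
      simpa [Step.concl, Step.data] using ho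
    rcases this with rfl | rfl
    · exact h1
    · exact h2

/-- Step (ii) (p. 175 l. 50 – p. 176 l. 17): draws `unitsSubjectInd12`, `cyclotomesInsulated`. [folklore] -/
theorem ii_holds_of (h1 : O .unitsSubjectInd12) (h2 : O .cyclotomesInsulated) : Step.ii.Holds L O :=
  Step.ii.holds_of_content fun _ o ho => by
    have : o = Obs.unitsSubjectInd12 ∨ o = Obs.cyclotomesInsulated := by
      simpa [Step.concl, Step.data] using ho
    rcases this with rfl | rfl
    · exact h1
    · exact h2

/-- Step (iii) (p. 176 l. 18–33): draws `singleLinkNecessary`. [folklore] -/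
theorem iii_holds_of (h : O .singleLinkNecessary) : Step.iii.Holds L O :=
  Step.iii.holds_of_content fun _ o ho => by
    have : o = Obs.singleLinkNecessary := by simpa [Step.concl, Step.data] using ho
    subst this; exact h

/-- Step (iv) (p. 176 l. 34 – p. 177 l. 8): content = `singleLinkNecessary ⟹ verticalShiftSolved`.
[folklore] -/
theorem iv_holds_of (h : O .singleLinkNecessary → O .verticalShiftSolved) : Step.iv.Holds L O :=
  Step.iv.holds_of_content fun hu o ho => by
    have : o = Obs.verticalShiftSolved := by simpa [Step.concl, Step.data] using ho
    subst this; exact h (hu .singleLinkNecessary (by decide))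

/-- Step (v) (p. 177 l. 9–34): content = `linkSplits ⟹ unitsRelatedContainers ∧
frobeniusLikeRelatedToCoric`. [folklore] -/
theorem v_holds_of
    (h : O .linkSplits → O .unitsRelatedContainers ∧ O .frobeniusLikeRelatedToCoric) :
    Step.v.Holds L O :=
  Step.v.holds_of_content fun hu o ho => by
    have : o = Obs.unitsRelatedContainers ∨ o = Obs.frobeniusLikeRelatedToCoric := by
      simpa [Step.concl, Step.data] using ho
    have hc := h (hu .linkSplits (by decide))
    rcases this with rfl | rfl
    · exact hc.1
    · exact hc.2

/-- Step (vi) (p. 177 l. 35 – p. 179 l. 18): content = `frobeniusLikeRelatedToCoric ⟹` the three log-Kummer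
observations. [folklore] -/
theorem vi_holds_of
    (h : O .frobeniusLikeRelatedToCoric →
      O .logKummerViaGaloisEvaluation ∧ O .conjSyncLogLinkCompatible ∧ O .cycRigidityApproaches) :
    Step.vi.Holds L O :=
  Step.vi.holds_of_content fun hu o ho => by
    have : o = Obs.logKummerViaGaloisEvaluation ∨ o = Obs.conjSyncLogLinkCompatible ∨
        o = Obs.cycRigidityApproaches := by
      simpa [Step.concl, Step.data] using ho
    have hc := h (hu .frobeniusLikeRelatedToCoric (by decide))
    rcases this with rfl | rfl | rfl
    · exact hc.1
    · exact hc.2.1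
    · exact hc.2.2

/-- Step (vii) (p. 179 l. 19 – p. 180 l. 10): content = `cycRigidityApproaches ⟹ symmetriesSeparate ∧
symmetriesMultiradial`. [folklore] -/
theorem vii_holds_of
    (h : O .cycRigidityApproaches → O .symmetriesSeparate ∧ O .symmetriesMultiradial) :
    Step.vii.Holds L O :=
  Step.vii.holds_of_content fun hu o ho => by
    have : o = Obs.symmetriesSeparate ∨ o = Obs.symmetriesMultiradial := by
      simpa [Step.concl, Step.data] using ho
    have hc := h (hu .cycRigidityApproaches (by decide))
    rcases this with rfl | rfl
    · exact hc.1
    · exact hc.2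

/-- Step (viii) (p. 180 l. 11–20): content = `symmetriesSeparate ⟹ conjugacyIndetResolved`. [folklore] -/
theorem viii_holds_of (h : O .symmetriesSeparate → O .conjugacyIndetResolved) : Step.viii.Holds L O :=
  Step.viii.holds_of_content fun hu o ho => by
    have : o = Obs.conjugacyIndetResolved := by simpa [Step.concl, Step.data] using ho
    subst this; exact h (hu .symmetriesSeparate (by decide))

/-- Step (ix) (p. 180 l. 21–42): content = `symmetriesSeparate ∧ unitsRelatedContainers ⟹
fmodTranslation`. [folklore] -/
theorem ix_holds_of
    (h : O .symmetriesSeparate → O .unitsRelatedContainers → O .fmodTranslation) :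
    Step.ix.Holds L O :=
  Step.ix.holds_of_content fun hu o ho => by
    have : o = Obs.fmodTranslation := by simpa [Step.concl, Step.data] using ho
    subst this
    exact h (hu .symmetriesSeparate (by decide)) (hu .unitsRelatedContainers (by decide))

/-! ## 3. The whole printed proof, modulo the one disputed inference -/

/-- **Cor. 3.12 from the chain, modulo the (xi-f) inference.** Granting every locus (`hL`), the content
implication of every node EXCEPT (xi-f) (`hcontents`), the solved (xi-f) implication (`hgap` — the team's
GAP form: "(xi-e)'s display ∧ (SHE)-as-fixed-value ⟹ constitutes-a-construction", p. 184 l. 19–29), and the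
two real edges (`hE` — finiteness and the (xi-f)→inequality edge of `Cor312Chain`), the Corollary follows.
Everything in the printed proof except `hgap` and `hE.inclusion` is expected to be dischargeable from the
frozen definitions (Team A rows A-0…A-3, A-5); what cannot be is exactly the GAP.
[claim: Mochizuki2012, status: disputed] -/
theorem cor312_of_contents_and_gap {V : Volumes} (hL : ∀ c, L c)
    (hcontents : ∀ s : Step, s ≠ Step.xi_f → (∀ o ∈ s.uses, O o) → ∀ o ∈ s.concl, O o)
    (hgap : O .displayXIe → O .sheMeansFixedValue → O .constitutesConstruction)
    (hE : RealEdges O V) : V.Cor312 := by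
  refine cor312_of_chain hL (fun s => ?_) hE
  by_cases hs : s = Step.xi_f
  · subst hs
    intro _ hu o ho
    have ho' : o = Obs.constitutesConstruction := by simpa [Step.concl, Step.data] using ho
    subst ho'
    exact hgap (hu .displayXIe (by decide)) (hu .sheMeansFixedValue (by decide))
  · exact s.holds_of_content (hcontents s hs)

end Cor312Proof

end IUTFork

end Summit.ABC
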